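import Summits.AtomisticToContinuum.FouriersLaw.Theses.ContactStieltjesMeasure
import Summits.AtomisticToContinuum.FouriersLaw.Theorems.ContactMeasureLimit.Negative.FalseWithoutResponse
import Summits.AtomisticToContinuum.FouriersLaw.Theorems.ContactStieltjesMeasureContactMeasureLimitStubLayerCake

/-!
# `ContactMeasureLimit` (stmt-AtomisticToContinuum-15250): the friction scan and the continuity proviso are load-bearing

Refuter (cdisprove) negative lemmas for crux (M) of route `ContactStieltjesMeasure`, companion to
`FalseWithoutResponse.lean` (the response clause is load-bearing). Two sorry-free refutations of
natural WEAKENINGS of the hypothesis / STRENGTHENINGS of the conclusion, both by parity-alternating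
families of step profiles (single atoms of the contact measure), using the explicit transform
`∫₀^∞ c·1_{(a,∞)}(t)·2t/(γ²+t²)² dt = c/(γ²+a²)`:

* `contactMeasureLimit_false_of_one_friction` — the `∀ γ > 0` inside the response clause is
  load-bearing: if the all-friction response clause is replaced by what Fourier's law gives at ONE
  friction `γ₀` (convergence of the represented response coefficients `(N-1)·γ₀·∫₀^∞ Φ_N k_{γ₀}`),
  the conclusion of (M) fails for every `γ₀ > 0`, even with the upper density of crux
  `ContactUpperDensity` (`N·Φ_N(t) ≤ C(1+t)`) added as a hypothesis: the contact measures `δ₀` and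
  `2δ_{γ₀}` have the same transform at `γ₀`. So a proof of (M) must use the response identity on a
  uniqueness set of frictions (all `γ > 0` as stated; a window or a progression in `γ²` would do —
  Widder, The Laplace Transform, VIII §5), never finitely many.
* `stieltjesContinuity_false_everywhere` — the proviso "at the continuity points of `M`" in the
  conclusion is sharp already for the pure-analysis core of the crux (the registered stub
  `stub_stieltjesContinuity` of lines `birth` / `escape-import`, child 1 of the staged split): with the
  transforms converging at EVERY friction and `0 ≤ F_N ≤ 1`, pointwise convergence at every `t > 0`
  (a fortiori to a continuous monotone `M`) fails — unit atoms at `1 + 1/(N+2)` / `1 - 1/(N+2)`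
  alternating with the parity of `N` give `F_N(1) = 0, 1, 0, 1, …`.
-/

namespace Summit.AtomisticToContinuum.FouriersLaw.Theorems.ContactMeasureLimit.Negative

open MeasureTheory Filter Set Topology

/-! ### Toolkit: the contact kernel against a step profile

(`∫_a^∞ 2t/(γ²+t²)² dt = (γ²+a²)⁻¹` is `layerCake_integral_Ioi_kernel` of the landed stub file
`ContactStieltjesMeasureContactMeasureLimitStubLayerCake`, reused.) -/

/-- A step profile `c·1_{(a,∞)}` with `c ≥ 0` is monotone. [folklore] -/
theorem step_monotone {c : ℝ} (hc : 0 ≤ c) (a : ℝ) :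
    Monotone (fun t : ℝ => if a < t then c else 0) := by
  intro x y hxy
  simp only
  split_ifs with hx hy
  · exact le_rfl
  · exact absurd (lt_of_lt_of_le hx hxy) hy
  · exact hc
  · exact le_rfl

/-- The contact transform of a step profile (an atom of mass `c` at `s = a ≥ 0` of the contact
measure): `∫₀^∞ c·1_{(a,∞)}(t)·2t/(γ²+t²)² dt = c/(γ²+a²)`. [folklore] -/
theorem integral_step_mul_contactKernel {γ : ℝ} (hγ : 0 < γ) (c : ℝ) {a : ℝ} (ha : 0 ≤ a) :
    ∫ t in Ioi (0 : ℝ), (if a < t then c else 0) * (2 * t / (γ ^ 2 + t ^ 2) ^ 2) =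
      c / (γ ^ 2 + a ^ 2) := by
  have h1 : (fun t : ℝ => (if a < t then c else 0) * (2 * t / (γ ^ 2 + t ^ 2) ^ 2)) =
      (Ioi a).indicator (fun t : ℝ => c * (2 * t / (γ ^ 2 + t ^ 2) ^ 2)) := by
    funext t
    simp only [indicator, mem_Ioi]
    split_ifs <;> ring
  rw [h1, setIntegral_indicator measurableSet_Ioi, Ioi_inter_Ioi, sup_eq_right.2 ha,
    integral_const_mul, (layerCake_integral_Ioi_kernel hγ ha).2, div_eq_mul_inv]

/-- A real sequence equal to `a` along the even and to `b` along the odd integers (`|a - b| ≥ 1`)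
has no limit. [folklore] -/
theorem not_tendsto_of_even_odd {u : ℕ → ℝ} {a b : ℝ} (hab : 1 ≤ |a - b|)
    (he : ∀ k : ℕ, 1 ≤ k → u (2 * k) = a) (ho : ∀ k : ℕ, 1 ≤ k → u (2 * k + 1) = b) (m : ℝ) :
    ¬ Tendsto u atTop (𝓝 m) := by
  intro h
  have hev : ∀ᶠ N in atTop, dist (u N) m < 1 / 2 :=
    (Metric.tendsto_nhds.1 h) (1 / 2) (by norm_num)
  obtain ⟨N₀, hN₀⟩ := eventually_atTop.1 hev
  have h1 := hN₀ (2 * (N₀ + 1)) (by omega)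
  have h2 := hN₀ (2 * (N₀ + 1) + 1) (by omega)
  rw [he (N₀ + 1) (by omega), Real.dist_eq] at h1
  rw [ho (N₀ + 1) (by omega), Real.dist_eq] at h2
  have h3 : |a - b| ≤ |a - m| + |b - m| := by
    calc |a - b| = |(a - m) - (b - m)| := by ring_nf
      _ ≤ |a - m| + |b - m| := abs_sub _ _
  linarith

/-! ### 1. The `∀ γ` of the response clause is load-bearing -/

/-- **ONE FRICTION IS NOT ENOUGH.** For every `γ₀ > 0` the following weakening of crux
`ContactMeasureLimit` is FALSE: "for every structural family `Φ` (each `Φ N`, `N ≥ 2`, monotone,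
`= 0` on `(-∞,0]`, bounded above) whose represented response coefficients AT THE FRICTION `γ₀`,
`(N-1)·γ₀·∫₀^∞ Φ_N(t)·2t/(γ₀²+t²)² dt`, converge, and which obeys the upper density
`N·Φ_N(t) ≤ C(1+t)` (`N ≥ N₀`, `t > 0`), there is a monotone `M` with `N·Φ_N(t) → M(t)` at every
continuity point `t > 0` of `M`". Witness: `N·Φ_N = 1_{(0,∞)}` (`N` even), `= 2·1_{(γ₀,∞)}` (`N` odd);
both response coefficients equal `((N-1)/N)·γ₀⁻¹ → γ₀⁻¹` (the contact measures `δ₀`, `2δ_{γ₀}` have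
the same transform `γ₀∫dμ/(γ₀²+s²)` at `γ₀`), `N·Φ_N ≤ 2`, but `N·Φ_N(t)` is `1,0,1,0,…` (`t ≤ γ₀`)
or `1,2,1,2,…` (`t > γ₀`), so it converges at NO `t > 0`, while a monotone `M` has a continuity point
in `(0,∞)`. Hence any proof of the crux must exploit the response identity on a uniqueness set of
frictions, not at finitely many. [folklore] -/
theorem contactMeasureLimit_false_of_one_friction {γ₀ : ℝ} (hγ₀ : 0 < γ₀) :
    ¬ (∀ Φ : ℕ → ℝ → ℝ,
        (∀ N : ℕ, 2 ≤ N →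
            Monotone (Φ N) ∧ (∀ s : ℝ, s ≤ 0 → Φ N s = 0) ∧ (∃ m : ℝ, ∀ s : ℝ, Φ N s ≤ m)) →
        (∃ κ : ℝ, Filter.Tendsto (fun N : ℕ => ((N : ℝ) - 1) * γ₀ *
            ∫ t in Set.Ioi (0 : ℝ), Φ N t * (2 * t / (γ₀ ^ 2 + t ^ 2) ^ 2))
            Filter.atTop (nhds κ)) →
        (∃ C : ℝ, ∃ N₀ : ℕ, ∀ N : ℕ, N₀ ≤ N → ∀ t : ℝ, 0 < t → (N : ℝ) * Φ N t ≤ C * (1 + t)) →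
        ∃ M : ℝ → ℝ, Monotone M ∧ ∀ t : ℝ, 0 < t → ContinuousAt M t →
          Filter.Tendsto (fun N : ℕ => (N : ℝ) * Φ N t) Filter.atTop (nhds (M t))) := by
  intro h
  -- the parity-alternating witness
  let Φ : ℕ → ℝ → ℝ := fun N t =>
    if Even N then (if (0 : ℝ) < t then 1 / (N : ℝ) else 0) else (if γ₀ < t then 2 / (N : ℝ) else 0)
  have hΦe : ∀ N : ℕ, Even N → Φ N = fun t => if (0 : ℝ) < t then 1 / (N : ℝ) else 0 :=
    fun N hN => by funext t; simp [Φ, hN]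
  have hΦo : ∀ N : ℕ, ¬ Even N → Φ N = fun t => if γ₀ < t then 2 / (N : ℝ) else 0 :=
    fun N hN => by funext t; simp [Φ, hN]
  have hstruct : ∀ N : ℕ, 2 ≤ N →
      Monotone (Φ N) ∧ (∀ s : ℝ, s ≤ 0 → Φ N s = 0) ∧ (∃ m : ℝ, ∀ s : ℝ, Φ N s ≤ m) := by
    intro N _
    by_cases hN : Even N
    · rw [hΦe N hN]
      refine ⟨step_monotone (by positivity) 0, fun s hs => if_neg (not_lt.2 hs), ⟨1 / (N : ℝ), ?_⟩⟩
      intro s; simp only; split_ifs <;> first | exact le_rfl | positivity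
    · rw [hΦo N hN]
      refine ⟨step_monotone (by positivity) γ₀, fun s hs => if_neg (not_lt.2 (hs.trans hγ₀.le)),
        ⟨2 / (N : ℝ), ?_⟩⟩
      intro s; simp only; split_ifs <;> first | exact le_rfl | positivity
  -- both parities have response coefficient ((N-1)/N)·γ₀⁻¹ at γ₀
  have htr : ∀ N : ℕ, ((N : ℝ) - 1) * γ₀ *
      ∫ t in Ioi (0 : ℝ), Φ N t * (2 * t / (γ₀ ^ 2 + t ^ 2) ^ 2) = ((N : ℝ) - 1) / N * γ₀⁻¹ := by
    intro N
    have hγ2 : γ₀ ^ 2 ≠ 0 := by positivity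
    by_cases hN : Even N
    · rw [hΦe N hN, integral_step_mul_contactKernel hγ₀ _ le_rfl]
      field_simp
      ring
    · rw [hΦo N hN, integral_step_mul_contactKernel hγ₀ _ hγ₀.le]
      field_simp
      ring
  have hconv : ∃ κ : ℝ, Tendsto (fun N : ℕ => ((N : ℝ) - 1) * γ₀ *
      ∫ t in Ioi (0 : ℝ), Φ N t * (2 * t / (γ₀ ^ 2 + t ^ 2) ^ 2)) atTop (𝓝 κ) := by
    refine ⟨1 * γ₀⁻¹, ?_⟩
    have hfrac : Tendsto (fun N : ℕ => ((N : ℝ) - 1) / N) atTop (𝓝 1) := by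
      have h1 : Tendsto (fun N : ℕ => (1 : ℝ) - 1 / (N : ℝ)) atTop (𝓝 (1 - 0)) :=
        tendsto_const_nhds.sub tendsto_one_div_atTop_nhds_zero_nat
      rw [sub_zero] at h1
      refine h1.congr' ?_
      filter_upwards [eventually_gt_atTop 0] with N hN
      have hN' : (N : ℝ) ≠ 0 := by exact_mod_cast hN.ne'
      field_simp
    exact (hfrac.mul_const γ₀⁻¹).congr' (Eventually.of_forall fun N => (htr N).symm)
  have hUD : ∃ C : ℝ, ∃ N₀ : ℕ, ∀ N : ℕ, N₀ ≤ N → ∀ t : ℝ, 0 < t →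
      (N : ℝ) * Φ N t ≤ C * (1 + t) := by
    refine ⟨2, 1, fun N hN t ht => ?_⟩
    have hNpos : (0 : ℝ) < N := by exact_mod_cast hN
    have hle : (N : ℝ) * Φ N t ≤ 2 := by
      by_cases hE : Even N
      · rw [hΦe N hE]
        have : (if (0 : ℝ) < t then 1 / (N : ℝ) else 0) ≤ 1 / (N : ℝ) := by
          rw [if_pos ht]
        calc (N : ℝ) * (if (0 : ℝ) < t then 1 / (N : ℝ) else 0) ≤ N * (1 / N) :=
              mul_le_mul_of_nonneg_left this hNpos.le
          _ = 1 := by field_simp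
          _ ≤ 2 := by norm_num
      · rw [hΦo N hE]
        have : (if γ₀ < t then 2 / (N : ℝ) else 0) ≤ 2 / (N : ℝ) := by
          split_ifs <;> first | exact le_rfl | positivity
        calc (N : ℝ) * (if γ₀ < t then 2 / (N : ℝ) else 0) ≤ N * (2 / N) :=
              mul_le_mul_of_nonneg_left this hNpos.le
          _ = 2 := by field_simp
    nlinarith
  obtain ⟨M, hMmono, hM⟩ := h Φ hstruct hconv hUD
  obtain ⟨t, ht, hcont⟩ := exists_pos_continuousAt_of_monotone hMmono
  have hlim := hM t ht hcont
  have heven : ∀ k : ℕ, 1 ≤ k → ((2 * k : ℕ) : ℝ) * Φ (2 * k) t = 1 := by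
    intro k hk
    have hpos : (0 : ℝ) < ((2 * k : ℕ) : ℝ) := by positivity
    rw [hΦe _ (even_two_mul k)]
    simp only [if_pos ht]
    field_simp
  by_cases htγ : t ≤ γ₀
  · have hodd : ∀ k : ℕ, 1 ≤ k → ((2 * k + 1 : ℕ) : ℝ) * Φ (2 * k + 1) t = 0 := by
      intro k _
      rw [hΦo _ (Nat.not_even_two_mul_add_one k)]
      simp only [if_neg (not_lt.2 htγ), mul_zero]
    exact not_tendsto_of_even_odd (a := 1) (b := 0) (by norm_num) heven hodd (M t) hlim
  · have hodd : ∀ k : ℕ, 1 ≤ k → ((2 * k + 1 : ℕ) : ℝ) * Φ (2 * k + 1) t = 2 := by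
      intro k _
      have hpos : (0 : ℝ) < ((2 * k + 1 : ℕ) : ℝ) := by positivity
      rw [hΦo _ (Nat.not_even_two_mul_add_one k)]
      simp only [if_pos (not_le.1 htγ)]
      field_simp
    exact not_tendsto_of_even_odd (a := 1) (b := 2) (by norm_num) heven hodd (M t) hlim

/-! ### 2. The continuity proviso of the conclusion is sharp -/

/-- **CONVERGENCE AT EVERY POINT IS TOO MUCH** — already for the pure-analysis core of the crux. The
strengthening of the registered stub `stub_stieltjesContinuity` (lines `birth`, `escape-import`;
child 1 `StieltjesContinuity` of the staged split of stmt-15250) in which "at the continuity points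
of `M`" is replaced by "at every `t > 0`" is FALSE: for `F_N = 1_{(a_N,∞)}` with
`a_N = 1 + 1/(N+2)` (`N` even), `1 - 1/(N+2)` (`N` odd), each `F_N` is structural with
`0 ≤ F_N ≤ 1`, every transform converges (`∫₀^∞ F_N k_γ = (γ²+a_N²)⁻¹ → (γ²+1)⁻¹`), but
`F_N(1) = 0, 1, 0, 1, …`. A fortiori no CONTINUOUS monotone limit exists, and the same holds for the
crux's conclusion along any family `Φ_N = F_N/N` satisfying an abstract all-friction convergence
hypothesis: the limit `1_{(1,∞)}` is seen only off its jump. [folklore] -/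
theorem stieltjesContinuity_false_everywhere :
    ¬ (∀ F : ℕ → ℝ → ℝ,
        (∀ N : ℕ, Monotone (F N) ∧ (∀ s : ℝ, s ≤ 0 → F N s = 0) ∧ (∃ m : ℝ, ∀ s : ℝ, F N s ≤ m)) →
        (∀ γ : ℝ, 0 < γ → ∃ L : ℝ, Filter.Tendsto
          (fun N : ℕ => ∫ t in Set.Ioi (0 : ℝ), F N t * (2 * t / (γ ^ 2 + t ^ 2) ^ 2))
          Filter.atTop (nhds L)) →
        ∃ M : ℝ → ℝ, Monotone M ∧ ∀ t : ℝ, 0 < t →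
          Filter.Tendsto (fun N : ℕ => F N t) Filter.atTop (nhds (M t))) := by
  intro h
  -- atom positions straddling 1
  let a : ℕ → ℝ := fun N => if Even N then 1 + 1 / ((N : ℝ) + 2) else 1 - 1 / ((N : ℝ) + 2)
  have ha_small : ∀ N : ℕ, 1 / ((N : ℝ) + 2) ≤ 1 / 2 := fun N =>
    one_div_le_one_div_of_le (by norm_num) (by linarith [Nat.cast_nonneg (α := ℝ) N])
  have ha_pos : ∀ N : ℕ, 0 < a N := fun N => by
    have h1 := ha_small N
    have h2 : (0 : ℝ) < 1 / ((N : ℝ) + 2) := by positivity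
    simp only [a]
    split_ifs <;> linarith
  have ha_dist : ∀ N : ℕ, |a N - 1| = 1 / ((N : ℝ) + 2) := fun N => by
    have h2 : (0 : ℝ) < 1 / ((N : ℝ) + 2) := by positivity
    simp only [a]
    split_ifs
    · rw [add_sub_cancel_left, abs_of_pos h2]
    · rw [sub_sub_cancel_left, abs_neg, abs_of_pos h2]
  have ha_lim : Tendsto a atTop (𝓝 1) := by
    refine Metric.tendsto_atTop.2 fun ε hε => ?_
    obtain ⟨N₀, hN₀⟩ := exists_nat_gt (1 / ε)
    refine ⟨N₀, fun N hN => ?_⟩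
    rw [Real.dist_eq, ha_dist]
    have hN' : (1 / ε : ℝ) < (N : ℝ) + 2 := by
      have : (N₀ : ℝ) ≤ N := by exact_mod_cast hN
      linarith
    have hpos : (0 : ℝ) < (N : ℝ) + 2 := by positivity
    rw [div_lt_iff₀ hpos]
    rw [div_lt_iff₀ hε] at hN'
    linarith
  -- the witness
  let F : ℕ → ℝ → ℝ := fun N t => if a N < t then 1 else 0
  have hstruct : ∀ N : ℕ, Monotone (F N) ∧ (∀ s : ℝ, s ≤ 0 → F N s = 0) ∧
      (∃ m : ℝ, ∀ s : ℝ, F N s ≤ m) := by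
    intro N
    refine ⟨step_monotone zero_le_one (a N), fun s hs => if_neg (not_lt.2 (hs.trans (ha_pos N).le)),
      ⟨1, fun s => ?_⟩⟩
    simp only [F]; split_ifs <;> norm_num
  have htrans : ∀ γ : ℝ, 0 < γ → ∃ L : ℝ, Tendsto
      (fun N : ℕ => ∫ t in Ioi (0 : ℝ), F N t * (2 * t / (γ ^ 2 + t ^ 2) ^ 2)) atTop (𝓝 L) := by
    intro γ hγ
    have hne : γ ^ 2 + 1 ^ 2 ≠ 0 := by positivity
    refine ⟨1 / (γ ^ 2 + 1 ^ 2), ?_⟩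
    have hlim : Tendsto (fun N : ℕ => 1 / (γ ^ 2 + a N ^ 2)) atTop (𝓝 (1 / (γ ^ 2 + 1 ^ 2))) :=
      Tendsto.div tendsto_const_nhds (tendsto_const_nhds.add (ha_lim.pow 2)) hne
    refine hlim.congr fun N => ?_
    exact (integral_step_mul_contactKernel hγ 1 (ha_pos N).le).symm
  obtain ⟨M, -, hM⟩ := h F hstruct htrans
  have hlim := hM 1 one_pos
  have heven : ∀ k : ℕ, 1 ≤ k → F (2 * k) 1 = 0 := by
    intro k _
    have hgt : ¬ a (2 * k) < 1 := by
      have : (0 : ℝ) < 1 / (((2 * k : ℕ) : ℝ) + 2) := by positivity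
      simp only [a, if_pos (even_two_mul k), not_lt]
      linarith
    simp only [F, if_neg hgt]
  have hodd : ∀ k : ℕ, 1 ≤ k → F (2 * k + 1) 1 = 1 := by
    intro k _
    have hlt : a (2 * k + 1) < 1 := by
      have : (0 : ℝ) < 1 / (((2 * k + 1 : ℕ) : ℝ) + 2) := by positivity
      simp only [a, if_neg (Nat.not_even_two_mul_add_one k)]
      linarith
    simp only [F, if_pos hlt]
  exact not_tendsto_of_even_odd (a := 0) (b := 1) (by norm_num) heven hodd (M 1) hlim

end Summit.AtomisticToContinuum.FouriersLaw.Theorems.ContactMeasureLimit.Negative
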